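import Mathlib.RingTheory.Polynomial.Chebyshev
import Mathlib.Algebra.BigOperators.NatAntidiagonal
import Mathlib.Data.Fin.Tuple.NatAntidiagonal
import Mathlib.Data.Fintype.BigOperators
import Mathlib.Analysis.SpecialFunctions.Trigonometric.Basic
import Mathlib.Data.Int.GCD
import Mathlib.Logic.Equiv.Defs
import HarnessLib

/-!
# The lens spaces `L(q; p₁, …, p_n) = S^{2n−1}/G` of every dimension — the definitions (Ikeda–Yamamoto 1979 §2–§3, Ikeda 1980
# §1–§2): the characters `χ_k` of `P_k` and `χ̃_k = χ_k − χ_{k−2}` of `H_k` on the maximal torus of `U(n)`, `dim P_k^G`,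
# `dim E_{k(k+2n−2)} = dim H_k^G`, Ikeda's polynomial `Ψ_{q,k}`, his sets `Ĩ₀(q,n)`, and the isometry / homotopy relations on weights

Layer `Literature/Analysis/InnerProduct`, namespace `Literature.Analysis.InnerProduct`; lane `lit-hodgefound`, prover seat
`lit-hodgefound-p06`, generation 44, row g44-#1 (DEFINITIONS file; every printed property — the character formula (3.10),
Ikeda–Yamamoto's Theorem 3.2 / Ikeda's (2.3) termwise for every `n`, the isospectrality criterion (2.2), Ikeda's Propositions
1.2, 2.5, 2.6, Corollary 1.3 and THEOREM 3.1 (i) with the explicit 5-dimensional pair `L(11; 1, 2, 4)`, `L(11; 1, 2, 8)` — is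
PROVED in the companion files `HigherLensSpaceSpectrum.lean` and `IkedaIsospectralLensSpaces.lean`). The three-dimensional case
`n = 2` is the tree's `LensSpaceMultiplicity.lean` (`threeSphereMonomialCharacter`, `lensMonomialCount`, `lensMultiplicity`);
the companion file proves that the present definitions specialise to those. Definitions with bodies only; no instance, no
notation, no named fact, no theorem.

## Sources, verbatim

A. Ikeda, Y. Yamamoto, *On the spectra of 3-dimensional lens spaces*, Osaka J. Math. **16** (1979) 447–469 (held text
`paper:doi-10-18910-4811`), §2 (p0005–p0006): "We denote by `P_k` the space of homogeneous polynomials of degree `k` with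
respect to `z₀, z₁, …, z_n, z̄₀, z̄₁, …, z̄_n` and `H_k` the subspace of `P_k` consisting of harmonic polynomials on `ℂ^{n+1}` …
**Proposition 2.1.** … `P_k = H_k ⊕ r²P_{k−2}`. … **Proposition 2.2.** `ℋ_k` is an eigenspace of `Δ` on `S^{2n+1}` with
eigenvalue `k(k+2n)` … **Corollary 2.3.** Let `L(q : p₀, ⋯, p_n)` be a lens space and `ℋ_k^G` the space of all `G`-invariant
functions in `ℋ_k` where `G = {g^k}_{k=0,1,…,q−1}`. Then we have `dim E_{k(k+2n)} = dim ℋ_k^G`. Moreover, for any integer `k`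
such that `dim ℋ_k^G ≠ 0`, `k(k+2n)` is an eigenvalue of `Δ` on `L(q : p₀, ⋯, p_n)` with multiplicity `dim ℋ_k^G` and no other
eigenvalues appear in the spectrum of `Δ`." §3 (p0006–p0007): "Let `χ_k` (resp. `χ̃_k`) be the character of the `G`-module `P_k`
(resp. `H_k`). Then by Proposition 2.1, we have (3.1) `χ̃_k = χ_k − χ_{k−2}`, where `χ_{−t} = 0` for `t > 0`, since `r²` is
invariant by `G`. The space `P_k` has a base consisting of all monomials of the form (3.2) `z^I·z̄^J = (z₀)^{i₀}⋯(z_n)^{i_n}·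
(z̄₀)^{j₀}⋯(z̄_n)^{j_n}` … `|I| + |J| = k`. Let `g` be the generator of `G` and `γ = exp 2π√−1/q`. Then for any monomial
`z^I·z̄^J`, we have (3.3) `g(z^I·z̄^J) = γ^{i₀p₀+⋯+i_np_n−j₀p₀−⋯−j_np_n}z^I·z̄^J`. Consider the formal expansion of (3.4)
`∏_{i=0}^{n}(1 − γ^{p_il}z)^{−1}(1 − γ^{−p_il}z)^{−1}`. Then it is easy to see that `χ_k(g^l)` is equal to the `z^k`'s
coefficient of (3.4)"; "(3.10) `dim ℋ_k^G = (1/q)∑_{l=0}^{q−1}(χ_k(g^l) − χ_{k−2}(g^l))`".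
A. Ikeda, *On lens spaces which are isospectral but not isometric*, Ann. Sci. ÉNS (4) **13** (1980) 303–315 (held text
`paper:doi-10-24033-asens-1384`), §1 (p0003): "the set `Ĩ(q, n)` is the set of `n`-tuples `(p₁, …, p_n)` of integers prime to
`q`, and put (1.1) `Ĩ₀(q,n) = {(p₁, …, p_n) ∈ Ĩ(q,n) | pᵢ ≢ ±p_j (mod q), 1 ≤ i < j ≤ n}`. We introduce an equivalence relation
in `Ĩ(q, n)` as follows: `(p₁, …, p_n)` is equivalent to `(s₁, …, s_n)` if and only if there is a number `l` and there are
numbers `eᵢ ∈ {−1, 1}` such that `(p₁, …, p_n)` is a permutation of `(e₁ls₁, …, e_nls_n) (mod q)`"; (p0004) "We shall define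
the map `Ψ_{q,k}` of `I₀(q, k)` into `Q(γ)[z]`. … (1.5) `Ψ_{q,k}((p₁, …, p_k)) = ∑_{l=1}^{q−1}∏_{i=1}^{k}(z − γ^{p_il})(z − γ^{−p_il})`";
§2 (p0008): "`g = diag(R(p₁/q), …, R(p_n/q))`, `R(θ) = ((cos 2πθ, sin 2πθ), (−sin 2πθ, cos 2πθ))`. Then `g` generates the cyclic
subgroup `G = {g^k}_{k=1}^{q}` of order `q` of the orthogonal group `O(2n)` … the lens space `L(q : p₁, …, p_n) = S^{2n−1}/G`, is
a Riemannian manifolds of positive constant curvature 1. … **Theorem 2.1** (cf. [2], [6]). Let `L = L(q : p₁, …, p_n)` and `L' =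
L(q : s₁, …, s_n)` be lens spaces. Then the following assertions are equivalent: 1. `L` is isometric to `L'`; 2. `L` is
diffeomorphic to `L'`; 3. `L` is homeomorphic to `L'`; 4. there is a number `l` and there are numbers `eᵢ ∈ {−1, 1}` such that
`(p₁, …, p_n)` is a permutation of `(e₁ls₁, …, e_nls_n) (mod q)`. **Theorem 2.2** (cf. [2], [3]). Let `L` and `L'` be as in the
above Theorem. Then `L` is homotopy equivalent to `L'` if and only if there are numbers `l` and `e ∈ {−1, 1}` such that `s₁⋯s_n
≡ ±l^np₁⋯p_n (mod q)`. … Let `Δ` be the Laplacian acting on the space of smooth functions on `L(q : p₁, …, p_n)`. Then each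
eigenvalue of `Δ` is of the form `k(k+2n−2)` (`k = 0, 1, 2, …`). We denote by `E_{k(k+2n−2)}` the eigenspace of `Δ` with
eigenvalue `k(k+2n−2)`. … (2.1) `F_q(z : p₁, …, p_n) = ∑_{k=0}^∞ (dim E_{k(k+2n−2)})z^k`."

## The dictionary (Ikeda 1980's `n`: the sphere is `S^{2n−1} ⊂ ℂ^n`, `n` weights; Ikeda–Yamamoto write `n + 1` for our `n`)

For the torus element `g^l = diag(e^{iφ₁}, …, e^{iφ_n}) ∈ U(n)` (`φᵢ = 2πpᵢl/q`), (3.3)–(3.4) give `χ_k(g^l) = ∑_{|I|+|J|=k}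
e^{i⟨I−J, φ⟩} = [z^k]∏ᵢ(1 − e^{iφᵢ}z)^{−1}(1 − e^{−iφᵢ}z)^{−1} = ∑_{k₁+⋯+k_n=k}∏ᵢ U_{kᵢ}(cos φᵢ)`, because one factor is
`(1 − 2cos φ·z + z²)^{−1} = ∑_j U_j(cos φ)zʲ` (`U_j` the Chebyshev polynomial of the second kind; `U_j(cos φ) = ∑_{a+b=j}
e^{i(a−b)φ}` is the character of the monomials `z^az̄^b`, `a + b = j`, in one variable). So we DEFINE `χ_k(c) := ∑_{x ∈
antidiagonalTuple n k}∏ᵢ U_{xᵢ}(cᵢ)` as a polynomial function of `c = (cos φᵢ)ᵢ` (`sphereMonomialCharacter`), `χ̃_k := χ_k −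
[k ≥ 2]χ_{k−2}` (`sphereHarmonicCharacter`, (3.1)), `dim P_k^G :=` the number of monomials `z^Iz̄^J`, indexed by the degrees
`xᵢ = Iᵢ + Jᵢ` (`∑xᵢ = k`) and the splittings `(Iᵢ, Jᵢ) ∈ antidiagonal xᵢ`, with `q ∣ ∑ᵢ(Iᵢ − Jᵢ)pᵢ` (`lensSpaceMonomialCount`,
(3.2)–(3.3) and the orthogonality of the characters of `G ≅ ℤ/q`), and `dim E_{k(k+2n−2)} = dim H_k^G := dim P_k^G −
[k ≥ 2]dim P_{k−2}^G` (`lensSpaceMultiplicity`, Corollary 2.3 and (3.1); the subtraction does not truncate, `dim P_{k−2}^G ≤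
dim P_k^G` by multiplication with `z₁z̄₁`, proved in the companion file). Ikeda's `(z − γ^{pl})(z − γ^{−pl}) = z² −
2cos(2πpl/q)z + 1`, so `Ψ_{q,k}(ω) = ∑_{l=1}^{q−1}∏ᵢ(z² − 2cos(2πωᵢl/q)z + 1) ∈ ℝ[z]` (`ikedaPolynomial`). The sets `Ĩ₀(q,n)`
(`IsIkedaWeights`) and the two relations of Theorems 2.1 (4) and 2.2 (`LensWeightsEquivalent`, `LensWeightsHomotopyEquivalent`)
are transcribed on weight families `p : Fin n → ℤ`; we do not formalise the lens space as a Riemannian manifold — by Theorems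
2.1–2.2 these arithmetic relations ARE isometry / homotopy equivalence of `L(q:p)` and `L(q:s)`, and by Corollary 2.3 the
numbers `lensSpaceMultiplicity q p k`, `k ≥ 0`, ARE the spectrum of `L(q:p)` (isospectrality = their equality for all `k`,
(2.2)).

## References

* [IkedaYamamoto1979] A. Ikeda, Y. Yamamoto, *On the spectra of 3-dimensional lens spaces*, Osaka J. Math. 16 (1979) 447–469,
  Propositions 2.1–2.2, Corollary 2.3, §3 (3.1)–(3.4), (3.10).
* [Ikeda1980] A. Ikeda, *On lens spaces which are isospectral but not isometric*, Ann. Sci. ÉNS (4) 13 (1980) 303–315, §1 (1.1),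
  (1.5), §2 Theorems 2.1–2.2, (2.1)–(2.3).
-/

noncomputable section

open Finset Polynomial Polynomial.Chebyshev

namespace Literature.Analysis.InnerProduct

open _root_.Real

/-! ### The characters of `P_k` and `H_k` on the maximal torus of `U(n)` -/

/-- **The character of `P_k`** (homogeneous polynomials of degree `k` in `z₁, …, z_n, z̄₁, …, z̄_n`) at the torus element
`diag(e^{iφ₁}, …, e^{iφ_n}) ∈ U(n)`, as a function of `c = (cos φᵢ)ᵢ`: `χ_{P_k}(c) = ∑_{k₁+⋯+k_n = k}∏ᵢ U_{kᵢ}(cᵢ)` — the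
`z^k`-coefficient of Ikeda–Yamamoto's `∏ᵢ(1 − γ^{pᵢl}z)^{−1}(1 − γ^{−pᵢl}z)^{−1} = ∏ᵢ ∑_j U_j(cos φᵢ)zʲ` ("it is easy to see that
`χ_k(g^l)` is equal to the `z^k`'s coefficient of (3.4)"); `U_j(cos φ) = ∑_{a+b=j}e^{i(a−b)φ}` is the character of the monomials
`z^az̄^b` of degree `j` in one variable. For `n = 2` this is `threeSphereMonomialCharacter` of `LensSpaceMultiplicity.lean`.
[cite: IkedaYamamoto1979, §3 (3.2)–(3.4)] -/
def sphereMonomialCharacter (n k : ℕ) (c : Fin n → ℝ) : ℝ :=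
  ∑ x ∈ Finset.Nat.antidiagonalTuple n k, ∏ i, (U ℝ (x i)).eval (c i)

/-- **The character of `H_k`** (harmonic polynomials of degree `k` on `ℂ^n`, i.e. the eigenspace of `Δ_{S^{2n−1}}` for
`k(k+2n−2)`) at `diag(e^{iφ₁}, …, e^{iφ_n})`, as a function of `c = (cos φᵢ)ᵢ`: `χ̃_k = χ_k − χ_{k−2}` ("`P_k = H_k ⊕ r²P_{k−2}`",
with `χ_{−1} = χ_{−2} = 0`). [cite: IkedaYamamoto1979, Proposition 2.1 and §3 (3.1)] -/
def sphereHarmonicCharacter (n k : ℕ) (c : Fin n → ℝ) : ℝ :=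
  sphereMonomialCharacter n k c - if 2 ≤ k then sphereMonomialCharacter n (k - 2) c else 0

/-! ### The invariant-monomial count `dim P_k^G` and the multiplicity `dim E_{k(k+2n−2)} = dim H_k^G` of `L(q; p₁, …, p_n)` -/

/-- **`dim P_k^G` for the lens space `L(q; p₁, …, p_n) = S^{2n−1}/G`**, `G = ⟨g⟩`, `g = diag(γ^{p₁}, …, γ^{p_n})`, `γ = e^{2πi/q}`:
the number of monomials `z^Iz̄^J = ∏ᵢ zᵢ^{Iᵢ}z̄ᵢ^{Jᵢ}` of degree `|I| + |J| = k` — indexed by the degrees `xᵢ = Iᵢ + Jᵢ` in the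
pair `(zᵢ, z̄ᵢ)` (`∑ᵢ xᵢ = k`) and the splittings `(Iᵢ, Jᵢ) ∈ antidiagonal xᵢ` — that are `G`-invariant, i.e. with
`q ∣ ∑ᵢ(Iᵢ − Jᵢ)pᵢ` ("`g(z^I·z̄^J) = γ^{i₀p₀+⋯+i_np_n−j₀p₀−⋯−j_np_n}z^I·z̄^J`"). For `n = 2` this is `lensMonomialCount` of
`LensSpaceMultiplicity.lean`. [cite: IkedaYamamoto1979, §3 (3.2)–(3.3)] -/
def lensSpaceMonomialCount {n : ℕ} (q : ℕ) (p : Fin n → ℤ) (k : ℕ) : ℕ :=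
  ∑ x ∈ Finset.Nat.antidiagonalTuple n k, ∑ e ∈ Fintype.piFinset (fun i ↦ antidiagonal (x i)),
    if (q : ℤ) ∣ ∑ i, (((e i).1 : ℤ) - (e i).2) * p i then 1 else 0

/-- **THE MULTIPLICITY OF `k(k+2n−2)` IN THE SPECTRUM OF THE LENS SPACE `L(q; p₁, …, p_n) = S^{2n−1}/G`**: `dim E_{k(k+2n−2)} =
dim H_k^G = dim P_k^G − dim P_{k−2}^G` ("`dim E_{k(k+2n)} = dim ℋ_k^G` … and no other eigenvalues appear in the spectrum of `Δ`",
Corollary 2.3 for `S^{2n+1}`, i.e. our `S^{2n−1}` with `n ↦ n − 1`; `P_k = H_k ⊕ r²P_{k−2}` as `G`-modules, `r²` being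
`G`-invariant); for `k < 2` it is `dim P_k^G`. Ikeda's generating function is `F_q(z : p₁, …, p_n) = ∑_k (lensSpaceMultiplicity q p
k)z^k`. For `n = 2` this is `lensMultiplicity` of `LensSpaceMultiplicity.lean`. [cite: IkedaYamamoto1979, Corollary 2.3, Proposition
2.1, §3 (3.1) and (3.10); Ikeda1980, §2 (2.1)] -/
def lensSpaceMultiplicity {n : ℕ} (q : ℕ) (p : Fin n → ℤ) (k : ℕ) : ℕ :=
  lensSpaceMonomialCount q p k - if 2 ≤ k then lensSpaceMonomialCount q p (k - 2) else 0

/-! ### Ikeda's polynomial `Ψ_{q,k}`, his sets `Ĩ₀(q,n)`, and the isometry / homotopy relations on weights -/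

/-- **Ikeda's polynomial `Ψ_{q,k}(ω₁, …, ω_k) = ∑_{l=1}^{q−1}∏_{i=1}^{k}(z − γ^{ωᵢl})(z − γ^{−ωᵢl})`** (`γ = e^{2πi/q}`), written with
the real quadratic factors `(z − γ^{m})(z − γ^{−m}) = z² − 2cos(2πm/q)z + 1`, as an element of `ℝ[z]` (Ikeda: of `ℚ(γ)[z]`).
For an odd prime `q` it governs the spectrum of every lens space whose weights are complementary to `ω` (Proposition 2.5).
[cite: Ikeda1980, §1 (1.5)] -/
def ikedaPolynomial {k : ℕ} (q : ℕ) (ω : Fin k → ℤ) : ℝ[X] :=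
  ∑ l ∈ Finset.Ico 1 q, ∏ i, (X ^ 2 - Polynomial.C (2 * Real.cos (2 * π * l * ω i / q)) * X + 1)

/-- **Ikeda's set `Ĩ₀(q, n)`**: the weight family `(p₁, …, p_n)` consists of integers prime to `q` with `pᵢ ≢ p_j` and
`pᵢ ≢ −p_j (mod q)` for `i ≠ j` ("`Ĩ₀(q,n) = {(p₁, …, p_n) ∈ Ĩ(q,n) | pᵢ ≢ ±p_j (mod q), 1 ≤ i < j ≤ n}`", `Ĩ(q,n)` the
`n`-tuples of integers prime to `q`). The lens spaces `L(q : p₁, …, p_n)` with `(pᵢ) ∈ Ĩ₀(q,n)` form Ikeda's family `𝓛₀(q, n)`.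
[cite: Ikeda1980, §1 (1.1) and §2 (`𝓛₀(q,n)`)] -/
structure IsIkedaWeights {n : ℕ} (q : ℕ) (p : Fin n → ℤ) : Prop where
  /-- every weight is prime to `q` -/
  isCoprime : ∀ i, IsCoprime (p i) q
  /-- `pᵢ ≢ p_j (mod q)` for `i ≠ j` -/
  not_dvd_sub : ∀ i j, i ≠ j → ¬(q : ℤ) ∣ p i - p j
  /-- `pᵢ ≢ −p_j (mod q)` for `i ≠ j` -/
  not_dvd_add : ∀ i j, i ≠ j → ¬(q : ℤ) ∣ p i + p j

/-- **Ikeda's equivalence of weight families** — by Theorem 2.1 the criterion for `L(q : p₁, …, p_n)` and `L(q : s₁, …, s_n)` to be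
ISOMETRIC (equivalently diffeomorphic, equivalently homeomorphic): "there is a number `l` and there are numbers `eᵢ ∈ {−1, 1}` such
that `(p₁, …, p_n)` is a permutation of `(e₁ls₁, …, e_nls_n) (mod q)`". [cite: Ikeda1980, §1 (the equivalence relation on
`Ĩ(q,n)`) and §2 Theorem 2.1 (4)] -/
def LensWeightsEquivalent {n : ℕ} (q : ℕ) (p s : Fin n → ℤ) : Prop :=
  ∃ l : ℤ, ∃ e : Fin n → ℤ, (∀ i, e i = 1 ∨ e i = -1) ∧
    ∃ σ : Equiv.Perm (Fin n), ∀ i, p (σ i) ≡ e i * l * s i [ZMOD q]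

/-- **The homotopy criterion of Theorem 2.2** for `L(q : p₁, …, p_n)` and `L(q : s₁, …, s_n)`: "`L` is homotopy equivalent to `L'`
if and only if there are numbers `l` and `e ∈ {−1, 1}` such that `s₁⋯s_n ≡ ±l^np₁⋯p_n (mod q)`". [cite: Ikeda1980, §2 Theorem
2.2] -/
def LensWeightsHomotopyEquivalent {n : ℕ} (q : ℕ) (p s : Fin n → ℤ) : Prop :=
  ∃ l : ℤ, ∃ e : ℤ, (e = 1 ∨ e = -1) ∧ ∏ i, s i ≡ e * l ^ n * ∏ i, p i [ZMOD q]

end Literature.Analysis.InnerProduct
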